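import Literature.IUT.HodgeTheaters.StableCurveTemperedDataOfSpecialFibreQTowerComplete
import Literature.AnabelianGeometry.SemiGraphs.TemperedSpecialFibreTowerPiData
import HarnessLib

/-!
# [IUTchI] Prop. 2.4 (ii) at the genuine 𝔛-datum WITH its `Π`-equivariant structure `PiData`:
# (P0) and `hcof` are FIELDS of the record — Prop. 2.4 (ii) ⇐ `LevelObservation` + `hadm`

Mochizuki, *Inter-universal Teichmüller theory I*, kurims manuscript (May 2020), §2, Prop. 2.4 (ii) and its proof
pp. 50–51 ([IUTchI] Prop 2.4(ii) pp.50-51) [claim: Mochizuki2012, status: disputed] (D-0012 claim key; nothing of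
the series is asserted here), over Mochizuki, *Semi-graphs of anabelioids*, Publ. RIMS **42** (2006), Ex. 3.10
pp. 44–45 [cite: MochizukiSemiAnbd2006, Ex 3.10 pp.44-45].

PROOF-ONLY capstone (abc-iut cell, seat abc-iut-w4-d063; NV-L5 row `StableCurveTemperedData.Prop24QTower`).  The chain
`StableCurveTemperedDataOfSpecialFibreQTower` (p427380) → `…QTowerComplete` (p431978) proves Prop. 2.4 (ii) AS TYPED at
the genuine datum from the per-level arithmetic input `LevelObservation` ([SemiAnbd] Thm 5.4 (ii) / Ex 5.6) modulo
three binders: (P0) `∀ i, (admKerPi X T i).Normal`, `hcof`, `hadm`.  With abc-iut-L3-t2's origin-data record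
`P : SpecialFibreTower.PiData X d S T` (`TemperedSpecialFibreTowerPiData.lean`, GAP-LEDGER G-w4d063-1 (b)) the first
two ARE FIELDS: (P0) = `P.admKer_normal_pi` (verbatim: `admKerPi X T i` unfolds to `(T.admKer i).map Δ^temp_X.subtype`),
`hcof` = `P.N_cofinal`.  Result `prop24ii_ofPiData (P) (hadm) (hLev)`: at the genuine datum carrying `P`, Prop. 2.4 (ii)
⇐ `LevelObservation` + the one cofinality reading `hadm` ("the admissible kernels shrink to `1`").  No definitions, no
new `Prop` fact; `P` is origin data asserted for no curve; nothing here bears on [IUTchIII] Cor. 3.12.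
-/

noncomputable section

namespace Literature.IUT.HodgeTheaters

namespace StableCurveTemperedData

namespace OfSpecialFibre

open _root_.Topology
open Literature.AnabelianGeometry.SemiGraphs Literature.AnabelianGeometry.SemiGraphs.ProfiniteSemiGraph

variable {p : ℕ} [Fact p.Prime] (X : TemperedCurve p) (T : SpecialFibreTower ↥X.DeltaTemp)
  (d : X.GroupLevelData) (S : SpecialFibreData (X.toTemperedArithmeticGroup d))
  (h36 : S.Gc.Prop36Hypotheses)
  (Sigma SigmaHat : Set ℕ) (hsub : Sigma ⊆ SigmaHat) (hne : Sigma.Nonempty)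
  (hprime : ∀ q ∈ SigmaHat, q.Prime) (hp : p ∉ Sigma)
  (TpH : Subgroup S.chart.G)
  (HatH : Subgroup (TemperedGraphGroupData.exists_completion_of_prop36 S.Gc h36 S.chart).choose)
  (hle : TpH.map (TemperedGraphGroupData.exists_completion_of_prop36 S.Gc h36
    S.chart).choose_spec.choose.toMonoidHom ≤ HatH)
  (cuspMeetsH : {x : X.Pt // X.IsCusp x} → Prop)
  (P : SpecialFibreTower.PiData X d S T)

/-- **(P0) IS the record's field**: the binder `hP0 : ∀ i, (admKerPi X T i).Normal` of the quotient tower is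
`P.admKer_normal_pi` (same expression). ([IUTchI] Prop 2.4(ii) p.51) [claim: Mochizuki2012, status: disputed] -/
theorem admKerPi_normal_of_piData (P : SpecialFibreTower.PiData X d S T) (i : ℕ) : (admKerPi X T i).Normal :=
  P.admKer_normal_pi i

/-- **[IUTchI] Prop. 2.4 (ii) AS TYPED at the genuine 𝔛-datum carrying its `Π`-equivariant structure `P`**, from the
per-level arithmetic Prop. 2.1 (`LevelObservation` of the quotient tower built with (P0) := `P.admKer_normal_pi`) and the
cofinality reading `hadm` — `hcof := P.N_cofinal`, `hlim` discharged (`prop24ii_ofSpecialFibre_of_admKer_nhds_one`).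
([IUTchI] Prop 2.4(ii) pp.50-51) [claim: Mochizuki2012, status: disputed] -/
theorem prop24ii_ofPiData
    (hadm : ∀ U ∈ 𝓝 (1 : ↥X.DeltaTemp), ∃ j, ((T.admKer j : Subgroup ↥X.DeltaTemp) : Set ↥X.DeltaTemp) ⊆ U)
    (hLev : (qTowerOfSpecialFibreTower X T d S h36 Sigma SigmaHat hsub hne hprime hp TpH HatH hle cuspMeetsH
      P.admKer_normal_pi).LevelObservation) :
    (ofSpecialFibre X d S h36 Sigma SigmaHat hsub hne hprime hp TpH HatH hle cuspMeetsH).Prop24ii :=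
  prop24ii_ofSpecialFibre_of_admKer_nhds_one X T d S h36 Sigma SigmaHat hsub hne hprime hp TpH HatH hle cuspMeetsH
    P.admKer_normal_pi P.N_cofinal hadm hLev

end OfSpecialFibre

end StableCurveTemperedData

end Literature.IUT.HodgeTheaters

end
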